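import Mathlib
import Literature.Analysis.ODE.CodeListMeanValueExtension
import Summits.Ventures.FusionMHD.Models.CerfonFreidbergNstxLikeMidplane
import Summits.Ventures.FusionMHD.Models.CerfonFreidbergIterLikeCriticalPoint
import HarnessLib

/-!
# Ventures/FusionMHD — Models/CerfonFreidbergNstxLikeCriticalPoint.lean: the NSTX-like twin — THE magnetic axis is the ONLY critical point
# of the Cerfon–Freidberg NSTX-like flux of record in the bounding box of its model plasma, and its strict global minimiser there
# (kernel; four interval range certificates, no new Krawczyk)

HONEST FRAMING (LADDER-GRIDFUSION three columns; CF rung, qualitative companion of S2 #47 «F1.CF-AXIS-NSTX» and of the rider «#47″ CF-MIDPLANE»).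
Same mechanism as `Models/CerfonFreidbergIterLikeCriticalPoint.lean` (whose code list `CFIterLike.hExpr` of the vertical slope factor
`H(X, W; c) = G₂(X) + 2 G₄(X) W + 3 G₆ W²` is reused by name), on the NSTX-like box `11/50 ≤ X ≤ 89/50` (`= 1 ± ε`, `ε = 39/50`),
`|Y| ≤ 39/25` (`= κε`, `κ = 2`): FOUR range certificates over «(p511071's kernel coefficient box) × (X-piece) × (W ∈ [0, 1521/625])» for the
X-pieces [11/50, 61/100], [61/100, 1], [1, 139/100], [139/100, 89/50] give **`H ≥ 1/200 > 0` on the box** (the margin is genuinely smaller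
than the ITER-like 1/50: `H(11/50, 0) ≈ 0.009`).  Hence, for THE NSTX-like flux of record `CFNstxLike.U`: `U_Y = 2Y·H` has the sign of `Y`
(`dZ_U_pos/neg/eq_zero_iff`); **the critical set of `U` in the box is `{(X_a, 0)}`** (`criticalSet_box_eq`, with the midplane theorem
`midplane_isCriticalPoint_iff` of p517046); every vertical line is a strict valley with floor on the midplane and **`U(X_a, 0) < U(X, Y)` at
every other point of the box** (`U_axis_lt`).  Note the contrast kept from the midplane files: the NSTX-like flux is NOT convex along the
chord inboard (`dRR_inboard_neg`), yet the axis is still the unique critical point and the global minimiser of the box.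
CERTIFIED (kernel): as stated, for the model flux on that box.  MODELLED: analytic CF family (ideal MHD, Solov'ev profiles, fixed analytic
boundary); no stability content; nothing outside the box.  Typer/prover: gridfusion-model-5 (g5), 2026-08-27.
Citations: Freidberg 2014 §6.6.1 (6.151)–(6.155) [Freidberg2014]; Moore 1966 Thm 3.1 / Moore 1979 §4.3 [Moore1979].
-/

noncomputable section

open Set NonemptyInterval Matrix
open Literature.Analysis.ODE Literature.Analysis.ODE.FExpr
open Literature.Analysis.ValidatedNumerics Literature.Analysis.ValidatedNumerics.ITaylor
open Literature.MathematicalPhysics.MHD Literature.MathematicalPhysics.MHD.GradShafranov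
  Literature.MathematicalPhysics.MHD.CerfonFreidberg _root_.Real

namespace Summit.Ventures.FusionMHD.Models.CFNstxLike

/-! ## §1 Pieces, boxes and the four range certificates (code list `CFIterLike.hExpr` reused) -/

/-- The four `X`-pieces covering the NSTX-like chord range `[11/50, 89/50]`. -/
def xPieceN : Fin 4 → Iv :=
  ![⟨((11 / 50), (61 / 100)), by decide +kernel⟩, ⟨((61 / 100), 1), by decide +kernel⟩,
    ⟨(1, (139 / 100)), by decide +kernel⟩, ⟨((139 / 100), (89 / 50)), by decide +kernel⟩]

/-- The `W = Y²` range `[0, 1521/625]` (i.e. `|Y| ≤ 39/25 = κε`). -/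
def wRangeN : Iv := ⟨(0, (1521 / 625)), by decide +kernel⟩

/-- «p511071's coefficient box (coordinates 0–6 of `CFNstxLike.axKrawczyk.box`) × X-interval `I` × W-range». -/
def hBoxN (I : Iv) : Fin 9 → Iv :=
  fun i => if h : (i : ℕ) < 7 then axKrawczyk.box ⟨i, by omega⟩ else if (i : ℕ) = 7 then I else wRangeN

/-- Endpoints of the pieces and of the range (decided). -/
theorem piecesN_eq : ((xPieceN 0).fst = 11 / 50 ∧ (xPieceN 0).snd = 61 / 100) ∧ ((xPieceN 1).fst = 61 / 100 ∧ (xPieceN 1).snd = 1)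
    ∧ ((xPieceN 2).fst = 1 ∧ (xPieceN 2).snd = 139 / 100) ∧ ((xPieceN 3).fst = 139 / 100 ∧ (xPieceN 3).snd = 89 / 50)
    ∧ (wRangeN.fst = 0 ∧ wRangeN.snd = 1521 / 625) := by
  decide +kernel

/-- **THE FOUR RANGE CERTIFICATES:** on every piece the natural interval extension of `H` lies in `[1/200, 1/2]` (seeds ⟨64, 60, 56, 4, 0⟩). -/
theorem hN_range_cert : ∀ j : Fin 4,
    evalBoxLE ⟨64, 60, 56, 4, 0⟩ CFIterLike.hExpr (hBoxN (xPieceN j)) ⟨((1 / 200), (1 / 2)), by decide +kernel⟩ = true := by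
  decide +kernel

/-! ## §2 Bridge and membership -/

/-- The point `(coeff, X, W)` of the 9-space (coordinates 0–6 = `axZero`'s of the NSTX certificate). -/
def hPointN (X W : ℝ) : Fin 9 → ℝ :=
  fun i => if h : (i : ℕ) < 7 then axZero ⟨i, by omega⟩ else if (i : ℕ) = 7 then X else W

/-- Its coefficient part is `CFNstxLike.coeff`. -/
theorem hCoeffs_hPointN (X W : ℝ) : CFIterLike.hCoeffs (hPointN X W) = coeff := by
  funext k
  fin_cases k <;> simp [CFIterLike.hCoeffs, hPointN, coeff, axCoeffs, coeffs, axProj]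

/-- Coordinate 7 is `X`. -/
theorem hPointN_seven (X W : ℝ) : hPointN X W 7 = X := by
  simp [hPointN]

/-- Coordinate 8 is `W`. -/
theorem hPointN_eight (X W : ℝ) : hPointN X W 8 = W := by
  simp [hPointN]

/-- For `X ∈ I` and `W` in the range, `(coeff, X, W) ∈ hBoxN I`. -/
theorem hPointN_mem {I : Iv} {X W : ℝ} (hlo : (I.fst : ℝ) ≤ X) (hhi : X ≤ (I.snd : ℝ))
    (hW0 : ((wRangeN.fst : ℚ) : ℝ) ≤ W) (hW1 : W ≤ ((wRangeN.snd : ℚ) : ℝ)) :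
    hPointN X W ∈ boxSet (castBox (hBoxN I)) := by
  have hz := mem_boxSet_iff.mp axZero_mem
  rw [mem_boxSet_iff]
  intro i
  rw [castBox_apply, mem_ratCast_iff]
  by_cases hi : (i : ℕ) < 7
  · have h := hz ⟨i, by omega⟩
    rw [castBox_apply, mem_ratCast_iff] at h
    simp only [hBoxN, hPointN, hi, dif_pos]
    exact h
  · by_cases h7 : (i : ℕ) = 7
    · simp only [hBoxN, hPointN, h7, if_true]
      exact ⟨hlo, hhi⟩
    · simp only [hBoxN, hPointN, hi, h7, dif_neg, not_false_eq_true, if_false]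
      exact ⟨hW0, hW1⟩

/-! ## §3 The vertical slope factor is positive on the NSTX-like box; `U_Y` has the sign of `Y` -/

/-- **`H(X, Y²) ≥ 1/200 > 0` on the NSTX-like bounding box** `11/50 ≤ X ≤ 89/50`, `Y² ≤ 1521/625`. -/
theorem vertSlope_lb {X Y : ℝ} (h1 : (11 : ℝ) / 50 ≤ X) (h2 : X ≤ 89 / 50) (hY : Y ^ 2 ≤ 1521 / 625) :
    1 / 200 ≤ vertG₂ CFNstxLike.coeff X + 2 * vertG₄ CFNstxLike.coeff X * Y ^ 2 + 3 * vertG₆ CFNstxLike.coeff X * Y ^ 4 := by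
  obtain ⟨⟨a1, a2⟩, ⟨b1, b2⟩, ⟨c1, c2⟩, ⟨d1, d2⟩, ⟨w1, w2⟩⟩ := piecesN_eq
  have key : ∀ j : Fin 4, ((xPieceN j).fst : ℝ) ≤ X → X ≤ ((xPieceN j).snd : ℝ) →
      1 / 200 ≤ vertG₂ coeff X + 2 * vertG₄ coeff X * Y ^ 2 + 3 * vertG₆ coeff X * Y ^ 4 := by
    intro j hlo hhi
    have hW0 : ((wRangeN.fst : ℚ) : ℝ) ≤ Y ^ 2 := by rw [w1]; push_cast; positivity
    have hW1 : Y ^ 2 ≤ ((wRangeN.snd : ℚ) : ℝ) := by rw [w2]; push_cast; linarith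
    have hmem := hPointN_mem hlo hhi hW0 hW1
    have h := eval_mem_of_evalBoxLE (hN_range_cert j) hmem
    rw [mem_ratCast_iff] at h
    have hev : CFIterLike.hExpr.eval (hPointN X (Y ^ 2))
        = vertG₂ coeff X + 2 * vertG₄ coeff X * Y ^ 2 + 3 * vertG₆ coeff X * Y ^ 4 := by
      rw [CFIterLike.eval_hExpr, hCoeffs_hPointN, hPointN_seven, hPointN_eight]; ring
    rw [hev] at h
    have : (((1 : ℚ) / 200 : ℚ) : ℝ) = 1 / 200 := by push_cast; ring
    linarith [h.1]
  by_cases ha : X ≤ 61 / 100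
  · exact key 0 (by rw [a1]; push_cast; linarith) (by rw [a2]; push_cast; linarith)
  by_cases hb : X ≤ 1
  · exact key 1 (by rw [b1]; push_cast; linarith) (by rw [b2]; push_cast; linarith)
  by_cases hc : X ≤ 139 / 100
  · exact key 2 (by rw [c1]; push_cast; linarith) (by rw [c2]; push_cast; linarith)
  · exact key 3 (by rw [d1]; push_cast; linarith) (by rw [d2]; push_cast; linarith)

/-- `|Y| ≤ 39/25` gives `Y² ≤ 1521/625`. -/
theorem sq_le_of_mem_Icc {Y : ℝ} (hY : Y ∈ Icc (-(39 : ℝ) / 25) (39 / 25)) : Y ^ 2 ≤ 1521 / 625 := by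
  obtain ⟨h1, h2⟩ := hY
  nlinarith

/-- **`U_Y = 2Y · H(X, Y²)`** for the NSTX-like flux of record (tree `dZ_cfSolution_zero`). -/
theorem dZ_U_eq (X Y : ℝ) :
    dZ CFNstxLike.U X Y = 2 * Y * (vertG₂ CFNstxLike.coeff X + 2 * vertG₄ CFNstxLike.coeff X * Y ^ 2 + 3 * vertG₆ CFNstxLike.coeff X * Y ^ 4) := by
  have h : dZ (cfSolution 0 coeff) X Y = 2 * vertG₂ coeff X * Y + 4 * vertG₄ coeff X * Y ^ 3 + 6 * vertG₆ coeff X * Y ^ 5 :=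
    dZ_cfSolution_zero coeff X Y
  rw [show U = cfSolution 0 coeff from rfl, h]
  ring

/-- In the NSTX-like box, `U_Y > 0` above the midplane. -/
theorem dZ_U_pos {X Y : ℝ} (hX : X ∈ Icc (11 / 50 : ℝ) (89 / 50)) (hY : Y ∈ Icc (-(39 : ℝ) / 25) (39 / 25)) (hpos : 0 < Y) :
    0 < dZ CFNstxLike.U X Y := by
  have hH := vertSlope_lb hX.1 hX.2 (sq_le_of_mem_Icc hY)
  rw [dZ_U_eq]
  have : 0 < vertG₂ coeff X + 2 * vertG₄ coeff X * Y ^ 2 + 3 * vertG₆ coeff X * Y ^ 4 := by linarith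
  positivity

/-- In the NSTX-like box, `U_Y < 0` below the midplane. -/
theorem dZ_U_neg {X Y : ℝ} (hX : X ∈ Icc (11 / 50 : ℝ) (89 / 50)) (hY : Y ∈ Icc (-(39 : ℝ) / 25) (39 / 25)) (hneg : Y < 0) :
    dZ CFNstxLike.U X Y < 0 := by
  have hH := vertSlope_lb hX.1 hX.2 (sq_le_of_mem_Icc hY)
  rw [dZ_U_eq]
  have hp : 0 < vertG₂ coeff X + 2 * vertG₄ coeff X * Y ^ 2 + 3 * vertG₆ coeff X * Y ^ 4 := by linarith
  nlinarith

/-- **In the NSTX-like box `U_Y = 0` iff `Y = 0`.** -/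
theorem dZ_U_eq_zero_iff {X Y : ℝ} (hX : X ∈ Icc (11 / 50 : ℝ) (89 / 50)) (hY : Y ∈ Icc (-(39 : ℝ) / 25) (39 / 25)) :
    dZ CFNstxLike.U X Y = 0 ↔ Y = 0 := by
  constructor
  · intro h0
    by_contra hne
    rcases lt_or_gt_of_ne hne with hlt | hgt
    · exact absurd h0 (ne_of_lt (dZ_U_neg hX hY hlt))
    · exact absurd h0 (ne_of_gt (dZ_U_pos hX hY hgt))
  · intro h; rw [h]; exact dZ_cfSolution_zero_midplane coeff X

/-! ## §4 THE magnetic axis is the only critical point in the NSTX-like box -/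

/-- **A point of the NSTX-like box is a critical point of the flux of record iff it is the magnetic axis `(X_a, 0)`.** -/
theorem isCriticalPoint_iff_axis {X Y : ℝ} (hX : X ∈ Icc (11 / 50 : ℝ) (89 / 50)) (hY : Y ∈ Icc (-(39 : ℝ) / 25) (39 / 25)) :
    IsCriticalPoint CFNstxLike.U X Y ↔ X = CFNstxLike.Xa ∧ Y = 0 := by
  constructor
  · intro h
    have hY0 : Y = 0 := (dZ_U_eq_zero_iff hX hY).mp h.2
    subst hY0
    exact ⟨(midplane_isCriticalPoint_iff hX).mp h, rfl⟩
  · rintro ⟨rfl, rfl⟩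
    exact axis

/-- **The critical set of the NSTX-like flux of record in `[11/50, 89/50] × [−39/25, 39/25]` is `{(X_a, 0)}`.** -/
theorem criticalSet_box_eq :
    {p : ℝ × ℝ | p.1 ∈ Icc (11 / 50 : ℝ) (89 / 50) ∧ p.2 ∈ Icc (-(39 : ℝ) / 25) (39 / 25) ∧ IsCriticalPoint CFNstxLike.U p.1 p.2}
      = {(CFNstxLike.Xa, 0)} := by
  ext p
  simp only [mem_setOf_eq, mem_singleton_iff]
  constructor
  · rintro ⟨hX, hY, hc⟩
    obtain ⟨h1, h2⟩ := (isCriticalPoint_iff_axis hX hY).mp hc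
    exact Prod.ext h1 h2
  · intro hp
    subst hp
    refine ⟨Xa_mem_chord, ⟨by norm_num, by norm_num⟩, axis⟩

/-! ## §5 Vertical valleys and the global minimum at the axis (NSTX-like) -/

/-- The vertical section `Y ↦ U(X, Y)` is the even sextic of the tree. -/
theorem U_vertical_eq (X : ℝ) :
    CFNstxLike.U X = fun Y => vertG₀ CFNstxLike.coeff X + vertG₂ CFNstxLike.coeff X * Y ^ 2 + vertG₄ CFNstxLike.coeff X * Y ^ 4
      + vertG₆ CFNstxLike.coeff X * Y ^ 6 := by
  have h := cfSolution_zero_vertical coeff X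
  rw [show U = cfSolution 0 coeff from rfl]
  exact h

/-- Continuity of every vertical section. -/
theorem continuous_U_vertical (X : ℝ) : Continuous (CFNstxLike.U X) := by
  rw [U_vertical_eq]; fun_prop

/-- **Strict increase above the midplane** on `[0, 39/25]` for `X` in the NSTX-like chord range. -/
theorem strictMonoOn_U_vertical {X : ℝ} (hX : X ∈ Icc (11 / 50 : ℝ) (89 / 50)) :
    StrictMonoOn (CFNstxLike.U X) (Icc 0 (39 / 25 : ℝ)) := by
  apply strictMonoOn_of_deriv_pos (convex_Icc _ _) (continuous_U_vertical X).continuousOn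
  intro y hy
  rw [interior_Icc] at hy
  have h : 0 < dZ U X y := dZ_U_pos hX ⟨by linarith [hy.1], hy.2.le⟩ hy.1
  exact h

/-- **Strict decrease below the midplane** on `[−39/25, 0]`. -/
theorem strictAntiOn_U_vertical {X : ℝ} (hX : X ∈ Icc (11 / 50 : ℝ) (89 / 50)) :
    StrictAntiOn (CFNstxLike.U X) (Icc (-(39 : ℝ) / 25) 0) := by
  apply strictAntiOn_of_deriv_neg (convex_Icc _ _) (continuous_U_vertical X).continuousOn
  intro y hy
  rw [interior_Icc] at hy
  have h : dZ U X y < 0 := dZ_U_neg hX ⟨hy.1.le, by linarith [hy.2]⟩ hy.2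
  exact h

/-- **The midplane is the valley floor (NSTX-like):** `U(X, 0) < U(X, Y)` for `0 < |Y| ≤ 39/25`. -/
theorem U_midplane_lt_of_ne {X Y : ℝ} (hX : X ∈ Icc (11 / 50 : ℝ) (89 / 50)) (hY : Y ∈ Icc (-(39 : ℝ) / 25) (39 / 25))
    (hne : Y ≠ 0) : CFNstxLike.U X 0 < CFNstxLike.U X Y := by
  rcases lt_or_gt_of_ne hne with hlt | hgt
  · exact strictAntiOn_U_vertical hX ⟨hY.1, hlt.le⟩ ⟨by norm_num, le_rfl⟩ hlt
  · exact strictMonoOn_U_vertical hX ⟨le_rfl, by norm_num⟩ ⟨hgt.le, hY.2⟩ hgt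

/-- **THE NSTX-like axis is the strict global minimiser of the flux of record on its bounding box.** -/
theorem U_axis_lt {X Y : ℝ} (hX : X ∈ Icc (11 / 50 : ℝ) (89 / 50)) (hY : Y ∈ Icc (-(39 : ℝ) / 25) (39 / 25))
    (hne : (X, Y) ≠ (CFNstxLike.Xa, 0)) : CFNstxLike.U CFNstxLike.Xa 0 < CFNstxLike.U X Y := by
  by_cases hY0 : Y = 0
  · subst hY0
    have hXne : X ≠ Xa := fun h => hne (by rw [h])
    exact U_axis_lt_of_ne hX hXne
  · have h1 : U X 0 < U X Y := U_midplane_lt_of_ne hX hY hY0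
    by_cases hXa : X = Xa
    · rw [hXa] at h1 ⊢; exact h1
    · exact lt_trans (U_axis_lt_of_ne hX hXa) h1

/-- Minimum value and argmin in one statement (NSTX-like box). -/
theorem U_axis_le_iff {X Y : ℝ} (hX : X ∈ Icc (11 / 50 : ℝ) (89 / 50)) (hY : Y ∈ Icc (-(39 : ℝ) / 25) (39 / 25)) :
    CFNstxLike.U CFNstxLike.Xa 0 ≤ CFNstxLike.U X Y ∧ (CFNstxLike.U X Y = CFNstxLike.U CFNstxLike.Xa 0 ↔ (X, Y) = (CFNstxLike.Xa, 0)) := by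
  by_cases h : (X, Y) = (Xa, 0)
  · have hX' : X = Xa := congrArg Prod.fst h
    have hY' : Y = 0 := congrArg Prod.snd h
    subst hX' hY'
    exact ⟨le_rfl, by simp⟩
  · have hlt := U_axis_lt hX hY h
    exact ⟨hlt.le, ⟨fun he => absurd he (ne_of_gt hlt), fun he => absurd he h⟩⟩

end Summit.Ventures.FusionMHD.Models.CFNstxLike
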